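import Summits.CriticalPhenomena.PercolationContinuityZ3.Theorems.Transplant.FKDoubleFanOneSidedCoreCertA
import Summits.CriticalPhenomena.PercolationContinuityZ3.Theorems.Transplant.FKDoubleFanOneSidedCoreCertB
import Summits.CriticalPhenomena.PercolationContinuityZ3.Theorems.Transplant.FKDoubleFanOneSidedCoreCertC
import Summits.CriticalPhenomena.PercolationContinuityZ3.Theorems.Transplant.FKDoubleFanOneSidedFinal
import HarnessLib

/-!
# Double fans, one-sided far pairs: CORE ≥ 0, `FanCore q` for every `q ∈ [0,1]`, and the ONE-SIDED FAR THEOREM unconditionally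

Helper file (`--supports stmt-CriticalPhenomena-4575`), FK sub-lane `prim-bschramm-fk-3` (gen 33); builds on p205010 (kernel theorem, internal audit
signed; external expert review pending).  No sorries; standard axioms.  Memo `bschramm/prim-bschramm-fk-3/FAR-CROSS-VIII.md`.

`…OneSidedFinal` reduced LEMMA′ — and with it negative correlation of the cross-apex spokes `(a c_j, b c_k)` at EVERY distance across a
one-sided middle of a weighted double fan `K₂ ∨ P_{m+1}`, `0 < q ≤ 1` — to the single polynomial inequality `FanCore q`
(`roofF q t_f w_f (roofP q t_u w_u) (roofP q t_s w_s) ≥ 0`, `= (1−q)(2−q)·coreStruct` by `…OneSidedCoreForm`).  This file discharges it: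
* **`coreStruct_decomp`** — the exact identity (checked by `ring`)
  `coreStruct = V² + q(2−q)²·[t_s(F−U)² + t_u(F−S)² + t_f(U+S)²] + Σ_e t^e·R_e`,
  `F = w_s w_u t_f`, `U = w_f(1−w_s) t_u`, `S = (w_f−w_u) t_s`, `V = (2−q)(F−U) − 2(1−q)S + (2−q)(w_u w_s(1−w_f) − w_f(1−w_s)(1−w_u))`, with the
  fourteen remainder coefficients `R_e = coreR…` of `…OneSidedCoreCertA/B/C` (each `≥ 0` on `[0,1]⁴` by an explicit Bernstein-type certificate);
  at `q = 0` this is the rank-one structure `CORE(0) = 4[(α+m)² + t_f X₁ + t_u X₂ + t_s X₃ + X₄]`, at `q = 1` the product structure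
  `(1+t_f)(1+t_u)(1+t_s)·(linear)`; the `t_s`-component of `V` interpolates (`2(1−q)`) so that no tangential zero is left in the remainder;
* **`coreStruct_nonneg`**, **`fanCore_holds`** — `FanCore q` for all `0 ≤ q ≤ 1`;
* **`fanPhi_nonneg`** — LEMMA′: `fanPhi q F u s ≥ 0` for all `F, u, s ∈ InKE q`, `0 < q ≤ 1`;
* **`negCorr_spokes_cross_far_oneSided`** (and the mirror **`…'`**) — THE ONE-SIDED FAR THEOREM, now unconditional: for every weighted double
  fan (`card V = m+3`), `0 < q ≤ 1`, `j < k ≤ m` with the `b`-spokes strictly between `c_j` and `c_k` of weight `0`,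
  `φ(J_{a c_j} ∩ J_{b c_k}) ≤ φ(J_{a c_j})·φ(J_{b c_k})`.
[cite: Grimmett2006, §3.9 eq. (3.94) (pp. 63–64)] [folklore]
-/

noncomputable section

namespace Summit.CriticalPhenomena.PercolationContinuityZ3.Theorems

namespace FK

namespace ThreeApex

set_option maxHeartbeats 16000000 in
/-- **The CORE certificate identity**: `coreStruct = V² + q(2−q)²·(three weighted squares) + Σ_e t^e·R_e` (heartbeats raised for `ring`). [folklore] -/
theorem coreStruct_decomp (q tf wf tu wu ts ws : ℝ) :
    coreStruct q tf wf tu wu ts ws =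
      ((2 - q) * (ws * wu * tf - wf * (1 - ws) * tu) - 2 * (1 - q) * ((wf - wu) * ts) +
          (2 - q) * (wu * ws * (1 - wf) - wf * (1 - ws) * (1 - wu))) ^ 2 +
      q * (2 - q) ^ 2 * (ts * (ws * wu * tf - wf * (1 - ws) * tu) ^ 2 + tu * (ws * wu * tf - (wf - wu) * ts) ^ 2 +
          tf * (wf * (1 - ws) * tu + (wf - wu) * ts) ^ 2) +
      (coreR000 q wf wu ws + ts * coreR001 q wf wu ws + ts ^ 2 * coreR002 q wf wu + tu * coreR010 q wf wu ws +
        tu * ts * coreR011 q wf wu ws + tu * ts ^ 2 * coreR012 q wf wu + tf * coreR100 q wf wu ws + tf * ts * coreR101 q wf wu ws +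
        tf * ts ^ 2 * coreR102 q wf wu + tf * tu * coreR110 q wf wu ws + tf * tu * ts * coreR111 q wf wu ws + tf * tu * ts ^ 2 * coreR112 q wf wu +
        tf * tu ^ 2 * ts * coreR121 q wf ws + tf ^ 2 * tu * ts * coreR211 q wu ws) := by
  simp only [coreStruct, coreP20, coreP02, coreK, coreC22, coreR000, coreR001, coreR002, coreR010, coreR011, coreR012, coreR100, coreR101, coreR102, coreR110, coreR111, coreR112, coreR121, coreR211]
  ring

/-- **CORE ≥ 0** on the whole box: `t_f, t_u, t_s ≥ 0`, `w_f, w_u, w_s ∈ [0,1]`, `q ∈ [0,1]`. [folklore] -/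
theorem coreStruct_nonneg {q tf wf tu wu ts ws : ℝ} (hq0 : 0 ≤ q) (hq1 : q ≤ 1) (htf : 0 ≤ tf) (hwf0 : 0 ≤ wf) (hwf1 : wf ≤ 1)
    (htu : 0 ≤ tu) (hwu0 : 0 ≤ wu) (hwu1 : wu ≤ 1) (hts : 0 ≤ ts) (hws0 : 0 ≤ ws) (hws1 : ws ≤ 1) :
    0 ≤ coreStruct q tf wf tu wu ts ws := by
  have h000 : 0 ≤ coreR000 q wf wu ws := coreR000_nonneg hq0 hq1 hwf0 hwf1 hwu0 hwu1 hws0 hws1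
  have h001 : 0 ≤ coreR001 q wf wu ws := coreR001_nonneg hq0 hq1 hwf0 hwf1 hwu0 hwu1 hws0 hws1
  have h002 : 0 ≤ coreR002 q wf wu := coreR002_nonneg hq0 hq1 hwf0 hwf1 hwu0 hwu1
  have h010 : 0 ≤ coreR010 q wf wu ws := coreR010_nonneg hq0 hq1 hwf0 hwf1 hwu0 hwu1 hws0 hws1
  have h011 : 0 ≤ coreR011 q wf wu ws := coreR011_nonneg hq0 hq1 hwf0 hwf1 hwu0 hwu1 hws0 hws1
  have h012 : 0 ≤ coreR012 q wf wu := coreR012_nonneg hq0 hq1 hwf0 hwf1 hwu0 hwu1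
  have h100 : 0 ≤ coreR100 q wf wu ws := coreR100_nonneg hq0 hq1 hwf0 hwf1 hwu0 hwu1 hws0 hws1
  have h101 : 0 ≤ coreR101 q wf wu ws := coreR101_nonneg hq0 hq1 hwf0 hwf1 hwu0 hwu1 hws0 hws1
  have h102 : 0 ≤ coreR102 q wf wu := coreR102_nonneg hq0 hq1 hwf0 hwf1 hwu0 hwu1
  have h110 : 0 ≤ coreR110 q wf wu ws := coreR110_nonneg hq0 hq1 hwf0 hwf1 hwu0 hwu1 hws0 hws1
  have h111 : 0 ≤ coreR111 q wf wu ws := coreR111_nonneg hq0 hq1 hwf0 hwf1 hwu0 hwu1 hws0 hws1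
  have h112 : 0 ≤ coreR112 q wf wu := coreR112_nonneg hq0 hq1 hwf0 hwf1 hwu0 hwu1
  have h121 : 0 ≤ coreR121 q wf ws := coreR121_nonneg hq0 hq1
  have h211 : 0 ≤ coreR211 q wu ws := coreR211_nonneg hq0 hq1
  rw [coreStruct_decomp]
  positivity

/-- **`FanCore q` holds for every `q ∈ [0,1]`**: the fan-roof functional at the endpoint pair (roof, roof) is `(1−q)(2−q)·coreStruct ≥ 0`. [folklore] -/
theorem fanCore_holds {q : ℝ} (hq0 : 0 ≤ q) (hq1 : q ≤ 1) : FanCore q := by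
  intro tf wf tu wu ts ws htf hwf0 hwf1 htu hwu0 hwu1 hts hws0 hws1
  rw [roofF_roofP_roofP]
  have h1 : 0 ≤ 1 - q := sub_nonneg.2 hq1
  have h2 : 0 ≤ 2 - q := by linarith
  exact mul_nonneg (mul_nonneg h1 h2) (coreStruct_nonneg hq0 hq1 htf hwf0 hwf1 htu hwu0 hwu1 hts hws0 hws1)

/-- **LEMMA′** (unconditional): `fanPhi q F u s ≥ 0` for all `F, u, s ∈ InKE q`, `0 < q ≤ 1`. [folklore] -/
theorem fanPhi_nonneg {q : ℝ} (hq0 : 0 < q) (hq1 : q ≤ 1) (F u s : V5) (hF : InKE q F) (hu : InKE q u) (hs : InKE q s) :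
    0 ≤ fanPhi q F u s :=
  fanPhi_nonneg_of_core hq0 hq1 (fanCore_holds hq0.le hq1) F u s hF hu hs

/-- LEMMA′ on the relaxation: masses `≥ 0` and `(U_c)(F)`, `(U_b)(u)`, `(U_a)(s)` suffice (`0 < q < 1`). [folklore] -/
theorem fanPhi_nonneg_validU {q : ℝ} (hq0 : 0 < q) (hq1 : q < 1) {F u s : V5} (hF : F.Nonneg) (hFU : UCond q (swapAC F)) (hu : u.Nonneg)
    (huU : UCond q (swapAB u)) (hs : s.Nonneg) (hsU : UCond q s) : 0 ≤ fanPhi q F u s :=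
  fanPhi_nonneg_validU_of_core hq0 hq1 (fanCore_holds hq0.le hq1.le) hF hFU hu huU hs hsU

open MeasureTheory Literature.Probability.LatticeModels Literature.Probability.Percolation
open scoped Classical

variable {V : Type*} [Fintype V]
variable {a b : V} {c : ℕ → V} {m : ℕ}
variable (hab : a ≠ b) (hinj : ∀ j k, j ≤ m → k ≤ m → c j = c k → j = k) (hca : ∀ j, j ≤ m → c j ≠ a) (hcb : ∀ j, j ≤ m → c j ≠ b)
include hab hinj hca hcb

/-- **THE ONE-SIDED FAR THEOREM (unconditional).**  For every weighted double fan (`card V = m+3`, weights supported on the double-fan pairs),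
`0 < q ≤ 1`, and `j < k ≤ m` such that the `b`-spokes strictly between `c_j` and `c_k` carry weight `0`:
`φ(J_{a c_j} ∩ J_{b c_k}) ≤ φ(J_{a c_j})·φ(J_{b c_k})` — negative correlation at EVERY distance `k − j`. [folklore] -/
theorem negCorr_spokes_cross_far_oneSided (hcard : Fintype.card V = m + 3) {q : ℝ} (hq0 : 0 < q) (hq1 : q ≤ 1)
    (w : Sym2 V → unitInterval) (hsupp : ∀ e, e ∉ dfPairs a b c m → w e = 0) {j k : ℕ} (hjk : j < k) (hk : k ≤ m)
    (hb0 : ∀ i, j < i → i < k → w s(b, c i) = 0) :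
    (rcMeasureW w q ∅).real ({ω : BondConfig V | s(a, c j) ∈ ω} ∩ {ω | s(b, c k) ∈ ω}) ≤
      (rcMeasureW w q ∅).real {ω : BondConfig V | s(a, c j) ∈ ω} * (rcMeasureW w q ∅).real {ω : BondConfig V | s(b, c k) ∈ ω} :=
  negCorr_spokes_cross_far_oneSided_of_core hab hinj hca hcb hcard hq0 hq1 (fanCore_holds hq0.le hq1) w hsupp hjk hk hb0

/-- The mirror statement (unconditional): `a`-spokes vanishing strictly between `c_j` and `c_k` ⇒ `(b c_j, a c_k)` negatively correlated. [folklore] -/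
theorem negCorr_spokes_cross_far_oneSided' (hcard : Fintype.card V = m + 3) {q : ℝ} (hq0 : 0 < q) (hq1 : q ≤ 1)
    (w : Sym2 V → unitInterval) (hsupp : ∀ e, e ∉ dfPairs a b c m → w e = 0) {j k : ℕ} (hjk : j < k) (hk : k ≤ m)
    (ha0 : ∀ i, j < i → i < k → w s(a, c i) = 0) :
    (rcMeasureW w q ∅).real ({ω : BondConfig V | s(b, c j) ∈ ω} ∩ {ω | s(a, c k) ∈ ω}) ≤
      (rcMeasureW w q ∅).real {ω : BondConfig V | s(b, c j) ∈ ω} * (rcMeasureW w q ∅).real {ω : BondConfig V | s(a, c k) ∈ ω} :=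
  negCorr_spokes_cross_far_oneSided_of_core' hab hinj hca hcb hcard hq0 hq1 (fanCore_holds hq0.le hq1) w hsupp hjk hk ha0

end ThreeApex

end FK

end Summit.CriticalPhenomena.PercolationContinuityZ3.Theorems
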